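import Summits.ABC.IUTFork.Repair.CandInternal2FatEval
import Summits.ABC.IUTFork.Cor312PilotKummerNaturalWitness
import HarnessLib

/-!
# IUT REPAIR BRANCH (rung LADDER-ABC:A2.RP), class (i) INTERNAL, sub-cell B0, seat rp-d2 — `CandInternal14`: row RP-I18 «𝓘-INNER LINK
# TRANSPORT» — the sharpest form of what the log-shell class needs: the transport carrying the Θ-pilot's Kummer datum onto the q-pilot's
# acts THROUGH THE LOG-SHELL (by the action (i)(b) of shell elements). It gives RP-I06b, hence (with RP-I05) the hull target; it is free
# for unit-valued (Ind2)-moves and is the height condition for the honest value-group discrepancy `q^{1−j²}`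

Record file (D-0012) of the abc-iut cell, IUT REPAIR branch (plan/repair/REPAIR-SPEC.md v0.4; seat abc-iut-rp-d2, k = 14 ≡ 2 mod 3). TAKES NO
SIDE on [IUTchIII] Cor. 3.12 or on any author. The candidate is a `Prop`-valued DEFINITION over the frozen binders — a hypothesis, never
asserted; typed ≠ proved. Sequel to `CandInternal2` (RP-I05 `HInd3Hull`, RP-I06/I06b, `shellSat` «X·𝓘», `RhoMonotone`) and to the fat model
(`CandInternal2Fat`/`…FatEval`); the P♮ cell uses abc-iut-w5-d230's `Cor312PilotKummerNatural*`. DEFS-FREEZE respected; no fact; standard axioms.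

THE ROW RP-I18 — **`H S P qK` := ∃ m, ∃ Φ (a family of packet automorphisms), (L⊆) `qK ⊆ Φ · frobΨ m` AND (INNER) `Φ` acts on the column-`m`
Θ-datum through the log-shell: every `Φ·ψ` (`ψ ∈ frobΨ m`) is `ψ · ι` for some tuple `ι` of elements of the typed log-shell `MRData.shellPk`
(action (i)(b) `MRData.act`).** Reading: abc-iut-w5-d155's link transport (L) «q-datum = transport of the Θ-datum» in inclusion form
(`Cor312PinnedRegionsLinkResidual`, `Cor312PilotKummerCompatSubStatement`), with the transporting family required NOT to be an indeterminacy
but to be ABSORBED BY (Ind3): «the Θ/q discrepancy lies in the log-shell». SOURCE STATUS: NOT-IN-PRINT — and for the value-group part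
CONTRARY to print's own bookkeeping: [IUTchIII] `paper:url-4b091feeb646` Rmk. 3.11.1 (viii) p. 166 «the value group portions of the data …
are held rigid [i.e., are not subject to indeterminacies], while the unit group portions … are subject to the indeterminacies (Ind1), (Ind2),
(Ind3)»; Thm. 3.11 (ii) (Ind3) p. 156 l. 33–40 places UNIT-group images in the log-shell. So: for a unit-valued move (Ism = {±1} ⊆ 𝒪^× ⊆ 𝓘,
Prop. 1.2 (vi)/(vii)) INNER holds for free; for the honest discrepancy between `{(±q^{j²})_j}` and `{(±q)_j}` — multiplication by `q^{1−j²}`,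
a VALUE-GROUP element — INNER says `q^{1−j²} ∈ 𝓘`, the local height condition of RP-I06.
RESULTS. §1 `hQShellOrbitData_of_H : H → HQShellOrbitData` (RP-I06b), `hQShellOrbit_of_H` (monotone `ρ`), **(T-a) `statement_of_H : BridgeHyps →
QPinned → RhoMonotone → HInd3Hull → H → P.Statement`** (level H, jointly with RP-I05; vehicle V-H), pinned3 / typed-Thm-3.11 shapes. §2 (T-b)
`not_H_pinnedSetting` / `H_at_pinned_countermodel` (FAILS at CM: no 𝓘-inner transport exists there, since RP-I06b fails); **fat model:
`H_fat_iff : H ↔ 3 ≤ d`** at `fatPinned p d` (← the honest dilation `x ↦ q^{1−j²}·x` at label `j` IS 𝓘-inner iff `p^{1−j²} ∈ p^{−d}𝒪` for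
`j ≤ 2`; → through RP-I06b); P♮ cell `not_H_nat` (DEGENERATE ✗: `natData.act = 0` admits no inner transport of a nonzero datum). §3 packaged
`inner_profile`. [claim: Mochizuki2012, status: disputed] [cite: ScholzeStix2018, §2.2 pp. 9–10]
-/

noncomputable section

open Set

namespace Summit.ABC.IUTFork.Repair.CandInternal14

open Thm311 Cor312 Cor312Vol Literature.IUT.LogThetaLattice Summit.ABC.IUTFork.Repair.CandInternal2
  Summit.ABC.IUTFork.Repair.CandInternal2Fat Summit.ABC.IUTFork.Repair.CandInternal2FatEval

/-! ## 1. The candidate and (T-a) -/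

section General

variable {T : ThetaIndex} (S : LatticeSituation T) (P : Cor312.Setting S.toSituation)
  (ρ : (∀ v : T.V, v ∈ T.Vbad → Set (S.L.StarPacket v)) → ∀ (j : T.Label) (vQ : T.VQ), Set (S.L.Packet j vQ))
  (qK : ∀ v : T.V, v ∈ T.Vbad → Set (S.L.StarPacket v))

/-- **CANDIDATE `H` := row RP-I18 «𝓘-INNER LINK TRANSPORT» (class Internal, sub-cell B0; level H jointly with RP-I05) — hypothesis, NOT
asserted; typed ≠ proved.** There are a lattice index `m` and a family `Φ` of packet automorphisms such that (L⊆) the q-pilot's Kummer datum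
lies in the `Φ`-transport of the column-`m` Θ-datum, and (INNER) on that datum `Φ` acts through the typed log-shell: `Φ·ψ = ψ·ι` with `ι` a
tuple of elements of `MRData.shellPk` (action (i)(b) `MRData.act`). SOURCE: NOT-IN-PRINT; value-group part CONTRARY to [IUTchIII]
`paper:url-4b091feeb646` Rmk. 3.11.1 (viii) p. 166 «the value group portions … are held rigid»; unit-group part = Thm. 3.11 (ii) (Ind3) p. 156
l. 33–40 / Prop. 1.2 (vi)–(vii) (Ism ⊆ 𝒪^×). Reading choices: «transport» ↦ any `LogShells.PacketAut` (not required to lie in ⟨Ind1∪Ind2⟩);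
«through the log-shell» ↦ the frozen `act`/`shellPk`. [claim: Mochizuki2012, status: disputed] -/
@[claim "Mochizuki2012" "disputed"]
def H : Prop :=
  ∃ (m : ℤ) (Φ : S.L.PacketAut),
    (∀ (v : T.V) (hv : v ∈ T.Vbad), qK v hv ⊆ S.L.starAut Φ v '' (S.col P.n).frobΨ m v hv) ∧
    ∀ (v : T.V) (hv : v ∈ T.Vbad), ∀ ψ ∈ (S.col P.n).frobΨ m v hv, ∃ ι : S.L.StarPacket v,
      (∀ j : T.LabelStar, ι j ∈ (S.D P.n).shellPk j.1 (T.over v)) ∧ S.L.starAut Φ v ψ = (S.D P.n).act v hv ψ ι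

/-- **RP-I18 ⟹ RP-I06b**: an 𝓘-inner transport of the Θ-datum onto the q-datum puts the q-datum inside the log-shell orbit `frobΨ m · 𝓘`.
[claim: Mochizuki2012, status: disputed] -/
theorem hQShellOrbitData_of_H (h : H S P qK) : HQShellOrbitData S P qK := by
  obtain ⟨m, Φ, hL, hinner⟩ := h
  refine ⟨m, fun v hv κ hκ => ?_⟩
  obtain ⟨ψ, hψ, rfl⟩ := hL v hv hκ
  obtain ⟨ι, hι, hΦ⟩ := hinner v hv ψ hψ
  exact ⟨ψ, hψ, ι, hι, hΦ⟩

/-- RP-I18 ⟹ RP-I06 for a monotone region operator. [claim: Mochizuki2012, status: disputed] -/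
theorem hQShellOrbit_of_H (hmono : RhoMonotone S ρ) (h : H S P qK) : HQShellOrbit S P ρ qK :=
  hQShellOrbit_of_data S P ρ qK hmono (hQShellOrbitData_of_H S P qK h)

/-- **(T-a), level H: bridge hypotheses + the q-pin + a monotone `ρ` + RP-I05 + RP-I18 ⟹ the printed Statement** (vehicle V-H via
`CandInternal2.statement_of_H`). [claim: Mochizuki2012, status: disputed] -/
theorem statement_of_H (HB : BridgeHyps P) (hq : QPinned S P ρ qK) (hmono : RhoMonotone S ρ) (hA : HInd3Hull S P ρ)
    (h : H S P qK) : P.Statement :=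
  CandInternal2.statement_of_H S P ρ qK HB hq hA (hQShellOrbit_of_H S P ρ qK hmono h)

/-- The hull clause from RP-I05 + RP-I18 (monotone `ρ`). [claim: Mochizuki2012, status: disputed] -/
theorem hull_of_H (hmono : RhoMonotone S ρ) (hA : HInd3Hull S P ρ) (h : H S P qK) : PilotKummerCompatHull S P ρ qK :=
  CandInternal2.hull_of_H S P ρ qK hA (hQShellOrbit_of_H S P ρ qK hmono h)

/-- The director's shape with the three pins carried. [claim: Mochizuki2012, status: disputed] -/
theorem statement_of_pinned3_of_H (HB : BridgeHyps P) (hpin : PinnedRegions3 S P ρ qK) (hmono : RhoMonotone S ρ)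
    (hA : HInd3Hull S P ρ) (h : H S P qK) : P.Statement :=
  statement_of_H S P ρ qK HB hpin.1.2 hmono hA h

/-- The same from the typed Theorem 3.11 (carried). [claim: Mochizuki2012, status: disputed] -/
theorem statement_of_thm311_of_pinned3_of_H (F : FullSituation T) (P : Cor312.Setting F.toLatticeSituation.toSituation)
    (ρ : (∀ v : T.V, v ∈ T.Vbad → Set (F.L.StarPacket v)) → ∀ (j : T.Label) (vQ : T.VQ), Set (F.L.Packet j vQ))
    (qK : ∀ v : T.V, v ∈ T.Vbad → Set (F.L.StarPacket v)) (_hThm : F.Statement) (HB : BridgeHyps P)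
    (hpin : PinnedRegions3 F.toLatticeSituation P ρ qK) (hmono : RhoMonotone F.toLatticeSituation ρ)
    (hA : HInd3Hull F.toLatticeSituation P ρ) (h : H F.toLatticeSituation P qK) : P.Statement :=
  statement_of_pinned3_of_H F.toLatticeSituation P ρ qK HB hpin hmono hA h

end General

/-! ## 2. (T-b) at the countermodel, the fat-model profile, the P♮ cell -/

section Toy

open Cor312.Checks Cor312.IdentifiedNonVacuity Cor312Vol.NaiveWitness Cor312Vol.PinnedWitness Cor312Vol.PinnedHonest
  Cor312Vol.NaturalWitness

variable (p : ℕ) (d : ℕ) [hp : Fact p.Prime]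

/-- **(T-b): RP-I18 FAILS at the pinned countermodel** (it would give RP-I06b, which fails there: `q ∉ q⁴·𝒪`). [folklore] -/
theorem not_H_pinnedSetting : ¬ H (naiveFull p).toLatticeSituation (pinnedSetting p) (qDatum p) := fun h =>
  not_hQShellOrbitData_pinnedSetting p (hQShellOrbitData_of_H _ _ _ h)

omit hp d in
/-- **REPAIR-SPEC §2 (3), literally at `p = 2`.** [folklore] -/
theorem H_at_pinned_countermodel : ¬ H (naiveFull 2).toLatticeSituation (pinnedSetting 2) (qDatum 2) := by
  haveI : Fact (Nat.Prime 2) := ⟨Nat.prime_two⟩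
  exact not_H_pinnedSetting 2

/-- The HONEST TRANSPORT of abc-iut-w5-d155: at label `j`, multiplication by `q^{1−j²}` (a value-group element, NOT an indeterminacy) —
as a family of packet automorphisms. [folklore] -/
def dilationFamily : signShells.PacketAut := fun j _ =>
  LinearEquiv.smulOfNeZero ℚ _ ((p : ℚ) ^ ((1 : ℤ) - jsq j)) (ppow_ne_zero p _)

omit d in
/-- Its action on a packet line: `x ↦ p^{1−j²}·x`. [folklore] -/
theorem dilationFamily_apply (j : toyIndex.Label) (vQ : toyIndex.VQ) (x : signShells.Packet j vQ) :
    dilationFamily p j vQ x = ((p : ℚ) ^ ((1 : ℤ) - jsq j)) • x := rfl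

omit d in
/-- The honest transport carries the Θ-datum `{(±q^{j²})_j}` ONTO a set containing the q-datum `{(±q)_j}`. [folklore] -/
theorem qDatum_subset_dilation_Psi (v : toyIndex.V) (hv : v ∈ toyIndex.Vbad) :
    qDatum p v hv ⊆ signShells.starAut (dilationFamily p) v '' Psi p v := by
  intro f hf
  -- preimage: `ψ_j := p^{j²−1} · f_j` has line `±p^{j²}`
  refine ⟨fun j => ((p : ℚ) ^ (jsq j.1 - 1)) • f j, fun j => ?_, funext fun j => ?_⟩
  · have hq : (p : ℚ) ≠ 0 := Nat.cast_ne_zero.mpr hp.out.ne_zero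
    show line j.1 _ (((p : ℚ) ^ (jsq j.1 - 1)) • f j) = (p : ℚ) ^ ((j.1 : ℕ) ^ 2) ∨
      line j.1 _ (((p : ℚ) ^ (jsq j.1 - 1)) • f j) = -(p : ℚ) ^ ((j.1 : ℕ) ^ 2)
    rw [map_smul, smul_eq_mul]
    have hpow : (p : ℚ) ^ (jsq j.1 - 1) * (p : ℚ) ^ (1 : ℕ) = (p : ℚ) ^ ((j.1 : ℕ) ^ 2) := by
      rw [← zpow_natCast, ← zpow_natCast, ← zpow_add₀ hq]
      unfold jsq; congr 1; push_cast; ring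
    rcases hf j with h | h
    · left; rw [show line j.1 (toyIndex.over v) (f j) = (p : ℚ) ^ (1 : ℕ) from h, hpow]
    · right; rw [show line j.1 (toyIndex.over v) (f j) = -(p : ℚ) ^ (1 : ℕ) from h, mul_neg, hpow]
  · show dilationFamily p j.1 (toyIndex.over v) (((p : ℚ) ^ (jsq j.1 - 1)) • f j) = f j
    rw [dilationFamily_apply, smul_smul, ← zpow_add₀ (Nat.cast_ne_zero.mpr hp.out.ne_zero)]
    rw [show (1 : ℤ) - jsq j.1 + (jsq j.1 - 1) = 0 by ring, zpow_zero, one_smul]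

/-- The honest transport acts on any datum THROUGH the tuple `(p^{1−j²})_j`: `p^{1−j²}·ψ_j = ψ_j · p^{1−j²}` (coordinatewise multiplication).
[folklore] -/
theorem dilation_eq_act (n : ℤ) (v : toyIndex.V) (hv : v ∈ toyIndex.Vbad) (ψ : signShells.StarPacket v) :
    signShells.starAut (dilationFamily p) v ψ =
      ((fatFull p d).toLatticeSituation.D n).act v hv ψ (fun j => pt p j.1 (toyIndex.over v) ((1 : ℤ) - jsq j.1)) := by
  funext j
  show dilationFamily p j.1 (toyIndex.over v) (ψ j) = (line j.1 (toyIndex.over v) (ψ j)) • pt p j.1 (toyIndex.over v) ((1 : ℤ) - jsq j.1)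
  rw [dilationFamily_apply]
  apply (line j.1 (toyIndex.over v)).injective
  rw [map_smul, map_smul, line_pt, smul_eq_mul, smul_eq_mul, mul_comm]

/-- **FAT-MODEL PROFILE: RP-I18 ⟺ `3 ≤ d`** at `fatPinned p d`: the honest transport `x ↦ q^{1−j²}·x` is 𝓘-inner iff `p^{1−j²} ∈ p^{−d}𝒪` for
the labels `j ≤ 2` iff `d ≥ 3` (←); and RP-I18 ⟹ RP-I06b ⟺ `3 ≤ d` (→). [folklore] -/
theorem H_fat_iff : H (fatFull p d).toLatticeSituation (fatPinned p d) (qDatum p) ↔ 3 ≤ d := by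
  constructor
  · intro h
    exact (hQShellOrbitData_fat_iff p d).1 (hQShellOrbitData_of_H _ _ _ h)
  · intro hd
    refine ⟨0, dilationFamily p, fun v hv => ?_, fun v hv ψ _ => ⟨fun j => pt p j.1 (toyIndex.over v) ((1 : ℤ) - jsq j.1),
      fun j => ?_, dilation_eq_act p d _ v hv ψ⟩⟩
    · rw [fatFull_frobΨ]; exact qDatum_subset_dilation_Psi p v hv
    · show pt p j.1 (toyIndex.over v) ((1 : ℤ) - jsq j.1) ∈ pBall p j.1 (toyIndex.over v) (-(d : ℤ))
      rw [pt_mem_pBall_iff]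
      have hj4 : jsq j.1 ≤ 4 := by
        unfold jsq
        have hi : ((j.1 : toyIndex.Label) : ℕ) ≤ 2 := Nat.le_of_lt_succ j.1.isLt
        have : ((j.1 : toyIndex.Label) : ℕ) ^ 2 ≤ 2 ^ 2 := Nat.pow_le_pow_left hi 2
        exact_mod_cast this
      omega

omit hp d in
/-- **P♮ cell (DEGENERATE ✗, cause `natData.act = 0`)**: with the zero action no nonzero datum admits an 𝓘-inner transport — an automorphism
cannot send the nonzero Θ-point `onePt` to `0`. [folklore] -/
theorem not_H_nat : ¬ H natFull.toLatticeSituation natSetting qDatumNat := by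
  rintro ⟨m, Φ, -, hinner⟩
  obtain ⟨ι, -, hΦ⟩ := hinner () (Set.mem_univ _) (onePt ()) rfl
  have h0 : signShells.starAut Φ () (onePt ()) = 0 := hΦ
  have h1 : onePt () = 0 := by
    have := congrArg (signShells.starAut Φ ()).symm h0
    rwa [LinearEquiv.symm_apply_apply, map_zero] at this
  have h2 : line 1 () ((onePt ()) ⟨1, by decide⟩) = line 1 () ((0 : signShells.StarPacket ()) ⟨1, by decide⟩) :=
    congrArg (fun f : signShells.StarPacket () => line 1 () (f ⟨1, by decide⟩)) h1
  have h3 : line 1 () ((onePt ()) ⟨1, by decide⟩) = 1 := by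
    show line 1 () (lpt 1 () 1) = 1; exact line_lpt _ _ _
  rw [h3] at h2
  have h4 : line 1 () ((0 : signShells.StarPacket ()) ⟨1, by decide⟩) = 0 := map_zero _
  rw [h4] at h2
  exact one_ne_zero h2

/-- **RP-I18, PROFILE packaged**: FAILS at the countermodel; on the (Ind3)-contentful model `H ↔ 3 ≤ d` («the honest value-group discrepancy
`q^{1−j²}` lies in the typed log-shell» = 3 × height ≤ inflation), and at `d = 3` it holds with the typed interface + pins while RP-I05, the hull
clause and the Statement fail (INSUFFICIENT ALONE, like RP-I06b); DEGENERATE ✗ at P♮. [folklore] -/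
theorem inner_profile :
    ¬ H (naiveFull p).toLatticeSituation (pinnedSetting p) (qDatum p) ∧
    (∀ d : ℕ, H (fatFull p d).toLatticeSituation (fatPinned p d) (qDatum p) ↔ 3 ≤ d) ∧
    (H (fatFull p 3).toLatticeSituation (fatPinned p 3) (qDatum p) ∧
      PinnedRegions3 (fatFull p 3).toLatticeSituation (fatPinned p 3) (orbitRegion p) (qDatum p) ∧
      ¬ HInd3Hull (fatFull p 3).toLatticeSituation (fatPinned p 3) (orbitRegion p) ∧
      ¬ (fatPinned p 3).Statement) ∧
    ¬ H natFull.toLatticeSituation natSetting qDatumNat :=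
  ⟨not_H_pinnedSetting p, fun d => H_fat_iff p d, ⟨(H_fat_iff p 3).2 le_rfl, fatPinned_pinnedRegions3 p 3,
    fun h => by have := (hInd3Hull_fat_iff p 3).1 h; omega, fatPinned_not_statement p 3⟩, not_H_nat⟩

end Toy

end Summit.ABC.IUTFork.Repair.CandInternal14

end
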